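import Mathlib
import HarnessLib
import Summits.CriticalPhenomena.CardyFormulaZ2.Theses.CardySelfRefinement
import Literature.Probability.RandomPlanarGeometry.ChordalReversibility
import Literature.Probability.RandomPlanarGeometry.ConformalRectangle
import Literature.Probability.RandomPlanarGeometry.IsometryCovariance
import Literature.Probability.LatticeModels.BoundaryValues
import Literature.Probability.Percolation.FourArmGarbanSquareDomain
import Summits.CriticalPhenomena.CardyFormulaZ2.Theorems.CardySelfRefinementSymmetryUpgradeRTouchTriangleDomain
import Summits.CriticalPhenomena.CardyFormulaZ2.Theorems.CardySelfRefinementSymmetryUpgradeRTouchUpperLattice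

/-!
# The discrete triangle near its diagonal free arc: mesh component, free-arc sites, wired row,
# and completed open paths

Helper file for stub `stub_touchExponent` (S3) of line `SketchIdeatorTwo` of crux `SymmetryUpgradeR`
(stmt-CriticalPhenomena-17239, route CardySelfRefinement), helper L2 (`touchExponent_wiredArmLower`),
part 2: deterministic lattice geometry of the triangle Dobrushin domain `(Δ; -1, -i)` of
`touchExponent_triangleDomain` (`Δ = {re < 0, im < 0, re + im > -1}`, wired arc the legs, free arc
the hypotenuse) read at mesh `δ` along a `ZdDiscretisationFamily`.

* `touchExponent_meshDomain_tri` — the mesh graph on the sites of `Δ` is connected (monotone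
  staircases to the corner site `(-1, -1)`, convexity), so `meshDomain Δ δ = meshVertices Δ δ`;
* `touchExponent_frontier_tri` — frontier points of `Δ` lie on one of the three sides;
* `touchExponent_notMem_zdArcB` — a site four rows above the lowest row, with `w₀ ≤ -3` and
  `δ w₀ ≥ -1 + 1/128 + 2δ`, is NOT on the discrete free arc `B` once the free arc of the data is
  within Hausdorff distance `1/512` of the hypotenuse (`exists_frontier_near_of_mem_zdBoundary₀`,
  `dist_meshPoint_ge_of_mem_zdDiscreteArc`);
* `touchExponent_wiredArmLower_freeSite` (registered; `touchExponent_exists_zdArcB_near`) — the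
  lowest-row site below `z = -(1+i)/2` is a site of the discrete free arc within `3δ` of `z`;
* `touchExponent_mem_zdArcA_of_row` — a site of the row `v₁ = -1` off the discrete free arc is on
  the discrete wired arc;
* `touchExponent_bc_openConnIn` — an `ω`-open path through sites of `Δ` off the discrete free arc
  is open in the completed configuration `bcBondConfig ω`.
-/

noncomputable section

namespace Summit.CriticalPhenomena.CardyFormulaZ2.Theorems.SymmetryUpgradeR.SwallowingSkeleton

open MeasureTheory Filter Set Metric
open Literature.Probability.RandomPlanarGeometry Literature.Probability.LatticeModels
  Literature.Probability.Percolation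
open UpperHalfPlane (upperHalfPlaneSet)
open Literature.Probability.Percolation.TrackExchange
open Summit.CriticalPhenomena.CardyFormulaZ2.Cruxes.LagHandOff.HittingTournament
  (dist_meshPoint_ge_of_mem_zdDiscreteArc)

local notation3 "Δ" => {w : ℂ | w.re < 0 ∧ w.im < 0 ∧ -1 < w.re + w.im}

/-! ### The discrete triangle: one mesh component -/

/-- The open triangle is convex. -/
theorem touchExponent_tri_convex : Convex ℝ Δ := by
  rw [← touchExponent_tri_interior]
  exact (convex_convexHull ℝ _).interior

/-- Sites of the triangle at mesh `δ`, in integer coordinates. -/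
theorem touchExponent_mem_triV_iff {δ : ℝ} (hδ : 0 < δ) {x : Site 2} :
    x ∈ meshVertices Δ δ ↔ x 0 ≤ -1 ∧ x 1 ≤ -1 ∧ -1 < δ * ((x 0 : ℝ) + x 1) := by
  rw [mem_meshVertices_iff]
  simp only [mem_setOf_eq, meshPoint_re, meshPoint_im]
  constructor
  · rintro ⟨h0, h1, h2⟩
    have h0' : ((x 0 : ℤ) : ℝ) < 0 := neg_of_mul_neg_right h0 hδ.le
    have h1' : ((x 1 : ℤ) : ℝ) < 0 := neg_of_mul_neg_right h1 hδ.le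
    have h0'' : x 0 < 0 := by exact_mod_cast h0'
    have h1'' : x 1 < 0 := by exact_mod_cast h1'
    exact ⟨by omega, by omega, by linarith⟩
  · rintro ⟨h0, h1, h2⟩
    have h0' : ((x 0 : ℤ) : ℝ) ≤ -1 := by exact_mod_cast h0
    have h1' : ((x 1 : ℤ) : ℝ) ≤ -1 := by exact_mod_cast h1
    exact ⟨by nlinarith, by nlinarith, by linarith⟩

/-- Lattice neighbours inside the triangle are joined in the mesh graph (convexity). -/
theorem touchExponent_meshGraph_adj_tri {δ : ℝ} {x y : Site 2} (hx : x ∈ meshVertices Δ δ)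
    (hy : y ∈ meshVertices Δ δ) (h : (zdGraph 2).Adj x y) : (meshGraph Δ δ).Adj x y :=
  meshGraph_adj_iff.2 ⟨h, (touchExponent_tri_convex.segment_subset hx hy).trans subset_closure⟩

/-- The corner site `(-1, -1)` belongs to the triangle for `δ < 1/2`. -/
theorem touchExponent_corner_mem {δ : ℝ} (hδ : 0 < δ) (hδ2 : δ < 1 / 2) :
    (![-1, -1] : Site 2) ∈ meshVertices Δ δ := by
  rw [touchExponent_mem_triV_iff hδ]
  simp only [Matrix.cons_val_zero, Matrix.cons_val_one, Matrix.cons_val_fin_one, Int.cast_neg,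
    Int.cast_one]
  exact ⟨le_rfl, le_rfl, by nlinarith⟩

/-- Every site of the triangle is joined to the corner site `(-1, -1)` by a monotone staircase
inside the triangle. -/
theorem touchExponent_reach_corner {δ : ℝ} (hδ : 0 < δ) (hδ2 : δ < 1 / 2) :
    ∀ (n : ℕ) (x : Site 2) (hx : x ∈ meshVertices Δ δ), -x 0 - x 1 ≤ n + 2 →
      (meshVertexGraph Δ δ).Reachable ⟨x, hx⟩ ⟨![-1, -1], touchExponent_corner_mem hδ hδ2⟩ := by
  intro n
  induction n with
  | zero =>
    intro x hx hn
    obtain ⟨h0, h1, -⟩ := (touchExponent_mem_triV_iff hδ).1 hx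
    have : x = ![-1, -1] := by
      funext i; fin_cases i
      · show x 0 = -1; omega
      · show x 1 = -1; omega
    subst this
    exact SimpleGraph.Reachable.refl _
  | succ n ih =>
    intro x hx hn
    obtain ⟨h0, h1, h2⟩ := (touchExponent_mem_triV_iff hδ).1 hx
    by_cases hle : -x 0 - x 1 ≤ n + 2
    · exact ih x hx hle
    · rcases lt_or_ge (x 0) (-1) with h0' | h0'
      · -- step right
        set y : Site 2 := x + Pi.single 0 1 with hy
        have hy0 : y 0 = x 0 + 1 := by simp [hy]
        have hy1 : y 1 = x 1 := by simp [hy]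
        have hyV : y ∈ meshVertices Δ δ := by
          rw [touchExponent_mem_triV_iff hδ, hy0, hy1]
          push_cast
          exact ⟨by omega, h1, by nlinarith⟩
        have hadj : (meshVertexGraph Δ δ).Adj ⟨x, hx⟩ ⟨y, hyV⟩ := by
          rw [SimpleGraph.induce_adj]
          exact touchExponent_meshGraph_adj_tri hx hyV ((zdGraph_adj_iff x y).2 ⟨0, Or.inl rfl⟩)
        exact hadj.reachable.trans (ih y hyV (by rw [hy0, hy1]; omega))
      · -- step up
        have hx0 : x 0 = -1 := le_antisymm h0 h0'
        set y : Site 2 := x + Pi.single 1 1 with hy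
        have hy0 : y 0 = x 0 := by simp [hy]
        have hy1 : y 1 = x 1 + 1 := by simp [hy]
        have hyV : y ∈ meshVertices Δ δ := by
          rw [touchExponent_mem_triV_iff hδ, hy0, hy1]
          push_cast
          exact ⟨h0, by omega, by nlinarith⟩
        have hadj : (meshVertexGraph Δ δ).Adj ⟨x, hx⟩ ⟨y, hyV⟩ := by
          rw [SimpleGraph.induce_adj]
          exact touchExponent_meshGraph_adj_tri hx hyV ((zdGraph_adj_iff x y).2 ⟨1, Or.inl rfl⟩)
        exact hadj.reachable.trans (ih y hyV (by rw [hy0, hy1]; omega))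

/-- **The discrete triangle is a single mesh component**: `meshDomain Δ δ = meshVertices Δ δ`
for `0 < δ < 1/2`. -/
theorem touchExponent_meshDomain_tri {δ : ℝ} (hδ : 0 < δ) (hδ2 : δ < 1 / 2) :
    meshDomain Δ δ = meshVertices Δ δ := by
  refine meshDomain_eq_meshVertices_of_preconnected fun u v => ?_
  obtain ⟨hu0, hu1, -⟩ := (touchExponent_mem_triV_iff hδ).1 u.2
  obtain ⟨hv0, hv1, -⟩ := (touchExponent_mem_triV_iff hδ).1 v.2
  have h1 := touchExponent_reach_corner hδ hδ2 (-u.1 0 - u.1 1).toNat u.1 u.2 (by omega)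
  have h2 := touchExponent_reach_corner hδ hδ2 (-v.1 0 - v.1 1).toNat v.1 v.2 (by omega)
  exact h1.trans h2.symm

/-! ### The frontier of the triangle and the sites of the free arc -/

/-- Points of the frontier of the triangle lie on one of its three sides. -/
theorem touchExponent_frontier_tri {z : ℂ} (hz : z ∈ frontier Δ) :
    z.re ≤ 0 ∧ z.im ≤ 0 ∧ -1 ≤ z.re + z.im ∧ (z.re = 0 ∨ z.im = 0 ∨ z.re + z.im = -1) := by
  have hcl : closure Δ ⊆ {w : ℂ | w.re ≤ 0} ∩ {w : ℂ | w.im ≤ 0} ∩ {w : ℂ | -1 ≤ w.re + w.im} := by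
    refine closure_minimal ?_ ?_
    · rintro w ⟨h1, h2, h3⟩
      exact ⟨⟨h1.le, h2.le⟩, h3.le⟩
    · exact ((isClosed_le Complex.continuous_re continuous_const).inter
        (isClosed_le Complex.continuous_im continuous_const)).inter
        (isClosed_le continuous_const (Complex.continuous_re.add Complex.continuous_im))
  have hopen : IsOpen Δ := by rw [← touchExponent_tri_interior]; exact isOpen_interior
  rw [hopen.frontier_eq] at hz
  obtain ⟨hzc, hzn⟩ := hz
  obtain ⟨⟨h1, h2⟩, h3⟩ := hcl hzc
  refine ⟨h1, h2, h3, ?_⟩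
  by_contra hcon
  push Not at hcon
  exact hzn ⟨lt_of_le_of_ne h1 hcon.1, lt_of_le_of_ne h2 hcon.2.1, lt_of_le_of_ne h3 (Ne.symm hcon.2.2)⟩

/-- **Sites well above the hypotenuse and away from the acute corners are not on the discrete
free arc.** For the triangle Dobrushin domain (free arc the hypotenuse `[-i, -1]`) and data of a
discretisation family whose free arc is within Hausdorff distance `1/512` of the hypotenuse, a
site `w` with `w₀ + w₁ ≥ ⌊-1/δ⌋ + 5` (four rows above the lowest row of the triangle), `w₀ ≤ -3`
and `δ w₀ ≥ -1 + 1/128 + 2δ` is not a site of the discrete free arc `B`: a discrete boundary site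
is within `2δ` of the frontier (`exists_frontier_near_of_mem_zdBoundary₀`), which is impossible
along the hypotenuse and the leg `re = 0`, while along the leg `im = 0` the nearby frontier point
is at distance `≥ 1/256` from the hypotenuse, so that sites of the discrete free arc are at
distance `≥ 1/1024` from it (`dist_meshPoint_ge_of_mem_zdDiscreteArc`). -/
theorem touchExponent_notMem_zdArcB (D : DobrushinDomain) {E : ℝ → DiscreteDobrushin}
    (hcar : D.carrier = Δ) (hA1 : D.arc 1 = segment ℝ (-Complex.I) (-1 : ℂ))
    (hE : ZdDiscretisationFamily D E) {δ : ℝ} (hδ : 0 < δ) (hδ1 : δ ≤ 1 / 4096)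
    (hH : hausdorffEDist (E δ).arcB (D.arc 1) < ENNReal.ofReal (1 / 512)) {w : Site 2}
    (hw1 : ⌊-1 / δ⌋ + 5 ≤ hgtOf w) (hw2 : w 0 ≤ -3) (hw3 : -1 + 1 / 128 + 2 * δ ≤ δ * w 0) :
    w ∉ (E δ).zdArcB := by
  intro hB
  have hδeq : (E δ).δ = δ := hE.δ_eq δ
  have hΩ : (E δ).Ω = D.carrier := hE.Ω_eq δ
  obtain ⟨z', hz'f, hz'd⟩ := exists_frontier_near_of_mem_zdBoundary₀ (Dm := D.toJordanDomain) hΩ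
    (by rw [hδeq]; exact hδ) ((E δ).zdArcB_subset_zdBoundary hB)
  rw [hδeq] at hz'd
  rw [Complex.dist_eq] at hz'd
  have hre : |z'.re - δ * w 0| ≤ 2 * δ := by
    have := Complex.abs_re_le_norm (z' - meshPoint δ w)
    rw [Complex.sub_re, meshPoint_re] at this
    linarith
  have him : |z'.im - δ * w 1| ≤ 2 * δ := by
    have := Complex.abs_im_le_norm (z' - meshPoint δ w)
    rw [Complex.sub_im, meshPoint_im] at this
    linarith
  have hz'f' : z' ∈ frontier Δ := by rw [← hcar]; exact hz'f
  obtain ⟨-, -, -, hcase⟩ := touchExponent_frontier_tri hz'f'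
  rw [abs_le] at hre him
  have hw2' : δ * ((w 0 : ℤ) : ℝ) ≤ -3 * δ := by
    have : ((w 0 : ℤ) : ℝ) ≤ -3 := by exact_mod_cast hw2
    nlinarith
  rcases hcase with h0 | h0 | h0
  · -- the leg `re = 0` is far to the right
    linarith
  · -- the leg `im = 0`: the nearby frontier point is far from the hypotenuse
    have hz'F : z' ∈ frontier (E δ).Ω := by rw [hΩ]; exact hz'f
    have hK : (D.arc 1).Nonempty := ⟨_, D.pt_mem_arc_self 1⟩
    have hfar : ∀ q ∈ D.arc 1, (1 / 256 : ℝ) ≤ dist z' q := by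
      intro q hq
      rw [hA1] at hq
      obtain ⟨a', b', ha', -, hab', rfl⟩ := hq
      have e1 := Complex.abs_re_le_norm (z' - (a' • (-Complex.I) + b' • (-1 : ℂ)))
      have e2 := Complex.abs_im_le_norm (z' - (a' • (-Complex.I) + b' • (-1 : ℂ)))
      simp only [Complex.sub_re, Complex.sub_im, Complex.add_re, Complex.add_im, Complex.smul_re,
        Complex.smul_im, Complex.neg_re, Complex.neg_im, Complex.I_re, Complex.I_im,
        Complex.one_re, Complex.one_im, smul_eq_mul, mul_zero, neg_zero, mul_neg, mul_one,
        zero_add, add_zero, h0] at e1 e2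
      rw [Complex.dist_eq]
      rcases le_or_gt (1 / 256 : ℝ) a' with ha | ha
      · have : |(0 : ℝ) - -a'| = a' := by rw [sub_neg_eq_add, zero_add, abs_of_nonneg ha']
        linarith
      · have : 1 / 256 ≤ |z'.re - -b'| := by
          rw [abs_of_nonneg (by linarith)]
          linarith
        linarith
    have key := dist_meshPoint_ge_of_mem_zdDiscreteArc hK hH hz'F
      (by norm_num : (1 : ℝ) / 512 < 1 / 256) hfar hB
    rw [hδeq, Complex.dist_eq, ← norm_neg, neg_sub] at key
    linarith
  · -- the hypotenuse `re + im = -1` is four rows below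
    have hlt : -1 + 4 * δ < δ * ((w 0 : ℝ) + w 1) := by
      have hfl := Int.lt_floor_add_one (-1 / δ)
      have h5 : ((⌊-1 / δ⌋ + 5 : ℤ) : ℝ) ≤ (w 0 : ℝ) + w 1 := by
        simp only [hgtOf] at hw1; exact_mod_cast hw1
      push_cast at h5
      have e : δ * (-1 / δ) = -1 := by field_simp
      nlinarith [mul_le_mul_of_nonneg_left h5 hδ.le, mul_lt_mul_of_pos_left hfl hδ]
    linarith

/-- **A site of the discrete free arc next to the midpoint of the hypotenuse.** For the admissible
data of a discretisation family of the triangle domain whose discrete wired arc stays at distance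
`≥ 3/64` from `z = -(1+i)/2`, the lowest-row site `b = (⌊-1/(2δ)⌋, ⌊-1/δ⌋ + 1 - ⌊-1/(2δ)⌋)` (within
`3δ` of `z`) lies on the discrete free arc `B`: its lower neighbour is outside the triangle, so it
is a discrete boundary site, and boundary sites are on `A` or on `B`. -/
theorem touchExponent_exists_zdArcB_near (D : DobrushinDomain) {E : ℝ → DiscreteDobrushin}
    (hcar : D.carrier = Δ) (hE : ZdDiscretisationFamily D E) {δ : ℝ} (hδ : 0 < δ)
    (hδ1 : δ < 1 / 64) (hadm : (E δ).IsZdAdmissible)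
    (hside : ∀ v ∈ (E δ).zdArcA, 3 * (1 / 8) / 8 ≤ dist (meshPoint (E δ).δ v) (-(1 + Complex.I) / 2)) :
    ∃ w ∈ (E δ).zdArcB, dist (meshPoint δ w) (-(1 + Complex.I) / 2) ≤ 3 * δ := by
  set w : Site 2 := ![⌊-1 / (2 * δ)⌋, ⌊-1 / δ⌋ + 1 - ⌊-1 / (2 * δ)⌋] with hw
  have hwz : dist (meshPoint δ w) (-(1 + Complex.I) / 2) ≤ 3 * δ := touchExponent_dist_base_le hδ
  refine ⟨w, ?_, hwz⟩
  have hp1 := Int.floor_le (-1 / δ)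
  have hp2 := Int.lt_floor_add_one (-1 / δ)
  have hq1 := Int.floor_le (-1 / (2 * δ))
  have hq2 := Int.lt_floor_add_one (-1 / (2 * δ))
  have e1 : δ * (-1 / δ) = -1 := by field_simp
  have e2 : δ * (-1 / (2 * δ)) = -1 / 2 := by field_simp
  have hdom : meshDomain (E δ).Ω (E δ).δ = meshVertices Δ δ := by
    rw [hE.Ω_eq, hE.δ_eq, hcar, touchExponent_meshDomain_tri hδ (by linarith)]
  have hq0 : ⌊-1 / (2 * δ)⌋ ≤ -1 := by
    have : (⌊-1 / (2 * δ)⌋ : ℝ) < 0 := lt_of_le_of_lt hq1 (by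
      rw [div_neg_iff]; right; exact ⟨by norm_num, by positivity⟩)
    have : ⌊-1 / (2 * δ)⌋ < 0 := by exact_mod_cast this
    omega
  have hwV : w ∈ meshVertices Δ δ := by
    rw [touchExponent_mem_triV_iff hδ]
    simp only [hw, Matrix.cons_val_zero, Matrix.cons_val_one, Matrix.cons_val_fin_one, Int.cast_add,
      Int.cast_sub, Int.cast_one]
    refine ⟨hq0, ?_, ?_⟩
    · have : ((⌊-1 / δ⌋ + 1 - ⌊-1 / (2 * δ)⌋ : ℤ) : ℝ) ≤ -1 := by
        push_cast
        have h6 : (6 : ℝ) ≤ 1 / δ := by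
          rw [le_div_iff₀ hδ]; linarith
        have eN1 : -1 / δ = -(1 / δ) := by ring
        have eN2 : -1 / (2 * δ) = -(1 / δ) / 2 := by ring
        linarith
      exact_mod_cast this
    · nlinarith [mul_lt_mul_of_pos_left hp2 hδ]
  have hwD : w ∈ meshDomain (E δ).Ω (E δ).δ := by rw [hdom]; exact hwV
  -- the lower neighbour is outside the triangle
  set y : Site 2 := ![⌊-1 / (2 * δ)⌋ - 1, ⌊-1 / δ⌋ + 1 - ⌊-1 / (2 * δ)⌋] with hy
  have hwy : w = y + Pi.single 0 1 := by
    funext i; fin_cases i <;> simp [hw, hy]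
  have hadj : (zdGraph 2).Adj w y := (zdGraph_adj_iff w y).2 ⟨0, Or.inr hwy⟩
  have hyD : y ∉ meshDomain (E δ).Ω (E δ).δ := by
    rw [hdom, touchExponent_mem_triV_iff hδ]
    rintro ⟨-, -, h3⟩
    simp only [hy, Matrix.cons_val_zero, Matrix.cons_val_one, Matrix.cons_val_fin_one, Int.cast_add,
      Int.cast_sub, Int.cast_one] at h3
    nlinarith [mul_le_mul_of_nonneg_left hp1 hδ.le]
  have hbd : w ∈ (E δ).zdBoundary :=
    (E δ).meshBoundary_subset_zdBoundary (mem_meshBoundary_of_adj_not_mem hwD hadj hyD)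
  rcases hadm.zdBoundary_subset hbd with hA | hB
  · exfalso
    have := hside w hA
    rw [hE.δ_eq] at this
    linarith
  · exact hB

/-- **`touchExponent_wiredArmLower_freeSite`** (registered helper for `touchExponent_wiredArmLower`
/ `stub_touchExponent`; explicit form of `touchExponent_exists_zdArcB_near`): for the admissible
data of a discretisation family of the triangle domain whose discrete wired arc stays at distance
`≥ 3/64` from `z = -(1+i)/2`, some site of the discrete free arc lies within `3δ` of `z`. -/
theorem touchExponent_wiredArmLower_freeSite : ∀ (D : DobrushinDomain) (E : ℝ → DiscreteDobrushin), D.carrier = {w : ℂ | w.re < 0 ∧ w.im < 0 ∧ -1 < w.re + w.im} → ZdDiscretisationFamily D E → ∀ δ : ℝ, 0 < δ → δ < 1 / 64 → (E δ).IsZdAdmissible → (∀ v ∈ (E δ).zdArcA, 3 * (1 / 8) / 8 ≤ dist (meshPoint (E δ).δ v) (-(1 + Complex.I) / 2)) → ∃ w ∈ (E δ).zdArcB, dist (meshPoint δ w) (-(1 + Complex.I) / 2) ≤ 3 * δ :=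
  fun D _ hcar hE _ hδ hδ1 hadm hside => touchExponent_exists_zdArcB_near D hcar hE hδ hδ1 hadm hside

/-- **A discrete boundary site of the wired row.** A site `u` of the discrete triangle with
`u₁ = -1` which is not on the discrete free arc lies on the discrete wired arc `A`: its upper
neighbour is outside the triangle. -/
theorem touchExponent_mem_zdArcA_of_row (D : DobrushinDomain) {E : ℝ → DiscreteDobrushin}
    (hcar : D.carrier = Δ) (hE : ZdDiscretisationFamily D E) {δ : ℝ} (hδ : 0 < δ)
    (hδ1 : δ < 1 / 2) (hadm : (E δ).IsZdAdmissible) {u : Site 2} (hu : u ∈ meshVertices Δ δ)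
    (hu1 : u 1 = -1) (huB : u ∉ (E δ).zdArcB) : u ∈ (E δ).zdArcA := by
  have hdom : meshDomain (E δ).Ω (E δ).δ = meshVertices Δ δ := by
    rw [hE.Ω_eq, hE.δ_eq, hcar, touchExponent_meshDomain_tri hδ hδ1]
  have huD : u ∈ meshDomain (E δ).Ω (E δ).δ := by rw [hdom]; exact hu
  set y : Site 2 := u + Pi.single 1 1 with hy
  have hadj : (zdGraph 2).Adj u y := (zdGraph_adj_iff u y).2 ⟨1, Or.inl rfl⟩
  have hyD : y ∉ meshDomain (E δ).Ω (E δ).δ := by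
    rw [hdom, touchExponent_mem_triV_iff hδ]
    rintro ⟨-, h2, -⟩
    have : y 1 = u 1 + 1 := by simp [hy]
    omega
  have hbd : u ∈ (E δ).zdBoundary :=
    (E δ).meshBoundary_subset_zdBoundary (mem_meshBoundary_of_adj_not_mem huD hadj hyD)
  rcases hadm.zdBoundary_subset hbd with hA | hB
  · exact hA
  · exact absurd hB huB

/-- **Open paths off the free arc are paths of the completed configuration.** If `ω` (a lattice
configuration) joins `x` to `y` inside a set `S` of sites of the discrete triangle none of which
lies on the discrete free arc `B`, then the boundary-condition-completed configuration
`bcBondConfig ω` joins `x` to `y`: every edge of the path is an edge of `Ω_δ` (convexity) with no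
endpoint on `B`, hence keeps its state. -/
theorem touchExponent_bc_openConnIn (D : DobrushinDomain) {E : ℝ → DiscreteDobrushin}
    (hcar : D.carrier = Δ) (hE : ZdDiscretisationFamily D E) {δ : ℝ} (hδ : 0 < δ)
    (hδ1 : δ < 1 / 2) {ω : BondConfig (Site 2)} (hω : ω ⊆ (zdGraph 2).edgeSet) {S : Set (Site 2)}
    (hS : S ⊆ meshVertices Δ δ) (hSB : ∀ v ∈ S, v ∉ (E δ).zdArcB) {x y : Site 2}
    (h : ω ∈ openConnIn S x y) : (E δ).bcBondConfig ω ∈ openConnIn Set.univ x y := by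
  have hdom : meshDomain (E δ).Ω (E δ).δ = meshVertices Δ δ := by
    rw [hE.Ω_eq, hE.δ_eq, hcar, touchExponent_meshDomain_tri hδ hδ1]
  have h1 : ω ∩ S.sym2 ∈ openConnIn S x y := by
    obtain ⟨hx, hy, hr⟩ := h
    refine ⟨hx, hy, hr.mono fun p q hpq => ?_⟩
    rw [SimpleGraph.induce_adj, openGraph_adj] at hpq ⊢
    exact ⟨⟨hpq.1, Set.mk_mem_sym2_iff.2 ⟨p.2, q.2⟩⟩, hpq.2⟩
  have h2 : ω ∩ S.sym2 ⊆ (E δ).bcBondConfig ω := by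
    intro e he
    induction e using Sym2.ind with
    | h p q =>
      have hadj : (zdGraph 2).Adj p q := by
        have := hω he.1
        rwa [SimpleGraph.mem_edgeSet] at this
      obtain ⟨hp, hq⟩ := Set.mk_mem_sym2_iff.1 he.2
      refine ((E δ).mem_bcBondConfig_iff).2 ⟨?_, Or.inr ⟨he.1, fun v hv => ?_⟩⟩
      · rw [SimpleGraph.mem_edgeSet, discreteDomainGraph_adj_iff, hdom, hE.Ω_eq, hE.δ_eq, hcar]
        exact ⟨touchExponent_meshGraph_adj_tri (hS hp) (hS hq) hadj, hS hp, hS hq⟩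
      · rcases Sym2.mem_iff.1 hv with rfl | rfl
        · exact hSB _ hp
        · exact hSB _ hq
  exact openConnIn_mono (subset_univ S) x y (isUpperSet_openConnIn S x y h2 h1)

end Summit.CriticalPhenomena.CardyFormulaZ2.Theorems.SymmetryUpgradeR.SwallowingSkeleton

end
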